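import Summits.Ventures.HSemireg.WedgeHankelDivisorGeneric

/-!
# Venture HSemireg — THE FOURTH RANK REGIME `D > max(k+1, n+1−k)` OF A DIVISOR CLASS: no law, but a SYLVESTER WINDOW
# `n + 2 − D ≤ rank H_k ≤ min(k+1, n+1−k)` (and `≤ D` always)

HONEST FRAMING. Part of the Lean index of the computation cell `pub-hsemireg` (seat p10 gen 18, Sunday typer «UNIFORM-IN-n»).
LINEAR ALGEBRA OF HANKEL (catalecticant) MATRICES over a field ONLY: no variety, no cohomology theory, no sheaf, no Ext group, no semiregularity map;
nothing here says that HC / HC_CM / HC_AV holds; no Literature fact is declared or used.  Custodian versions as in `WedgeHankelSiegelIdeal` (1/3) and `WedgeHankelFrameChange`;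
the dictionary (divisor `Σ_i (P_i+1)[λ_i]` of the class `Σ_i exp(λ_i Θ)·p_i(Θ)`, total order `D = Σ_i (P_i+1)`) is QUOTED, never asserted.

WHAT IS IN THE TREE.  F2a `hankel1_expMul_sum` (`H_k = (cvMat (k+1))ᵀ · hkMat · cvMat (n+1−k)`), `rank_hankel1_expMul_sum_le` (`rank H_k ≤ D`, every `D`), `rank_cvMat`,
`hkMat_mulVecLin_injective`; F2c `cvMat_mulVecLin_injective` (`cvMat c` injective for `c ≤ D`), `range_hkMat_mulVecLin_eq_top`; G9 `rank_hankel1_expMul_sum_eq_min₃`: THREE regimes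
`rank H_k = min(D, k+1, n+1−k)` whenever `D ≤ k+1` OR `D ≤ n+1−k`, with the remark «the fourth regime `D > max(k+1, n+1−k)` has no law: the rank depends on the weights».
THIS FILE says what CAN be said there (namespace `Summit.Ventures.HSemireg.Wedge.HankelFrameChange` continued):
* §126 a generic SYLVESTER INEQUALITY for linear maps (`finrank_range_le_finrank_range_comp_add`: `dim range g ≤ dim range (f ∘ g) + dim ker f`) and for the matrix sandwich.
* §127 **`rank_hankel1_expMul_sum_ge`: `n + 2 ≤ D + rank H_k(Σ_i expMul λ_i q_i)`** for distinct `λ_i`, exact orders and `k + 1 ≤ D`, `n + 1 − k ≤ D` (`k ≤ n`) — in the fourth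
  regime both outer factors have FULL rank (`k+1` resp. `n+1−k`, F2c) and the middle one is invertible, so Sylvester bounds the rank from below by `(k+1) + (n+1−k) − D`;
  together with the size bounds (`rank_hankel1_le_min`) and F2a's `≤ D`: **`rank_hankel1_expMul_sum_window`**: `n + 2 − D ≤ rank H_k ≤ min(k+1, n+1−k)`.
* §128 the window COLLAPSES exactly at the boundary: for `D = max(k+1, n+1−k)` (when that max is `≥` the other size, i.e. always) the lower bound `n + 2 − D = min(k+1,n+1−k) + 1 − …`
  meets G9: `rank_hankel1_expMul_sum_boundary` (`D = k + 1 ≥ n + 1 − k` or `D = n + 1 − k ≥ k + 1` ⇒ `rank = min(k+1, n+1−k)`), so the fourth regime proper is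
  `D ≥ max(k+1, n+1−k) + 1`, where the window has `D − max(k+1, n+1−k) + 1 ≥ 2` admissible values — consistent with «no law».
NOT typed here: that every value of the window is attained (it is, over a field with enough elements; field-size dependent, e.g. over `𝔽₂` with nodes `0, 1, ∞` and
`n = 2`, `k = 1` the rank is forced); anything class-side.  New names only.
-/

open Module
open scoped Matrix

namespace Summit.Ventures.HSemireg.Wedge.HankelFrameChange

open Summit.Ventures.HSemireg.Wedge Summit.Ventures.HSemireg.Wedge.Hankel

variable (K : Type*) [Field K]

/-! ## §126. Sylvester's inequality -/

/-- **SYLVESTER (linear maps)**: `dim range g ≤ dim range (f ∘ g) + dim ker f` — rank–nullity for `f` restricted to `range g`, whose kernel embeds in `ker f`. -/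
theorem finrank_range_le_finrank_range_comp_add {U V W : Type*} [AddCommGroup U] [Module K U] [AddCommGroup V] [Module K V] [AddCommGroup W] [Module K W]
    [FiniteDimensional K U] [FiniteDimensional K V] (f : V →ₗ[K] W) (g : U →ₗ[K] V) :
    finrank K (LinearMap.range g) ≤ finrank K (LinearMap.range (f ∘ₗ g)) + finrank K (LinearMap.ker f) := by
  have h := LinearMap.finrank_range_add_finrank_ker (f.domRestrict (LinearMap.range g))
  rw [LinearMap.range_domRestrict, ← LinearMap.range_comp] at h
  have hk : finrank K (LinearMap.ker (f.domRestrict (LinearMap.range g))) ≤ finrank K (LinearMap.ker f) := by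
    rw [← Submodule.finrank_map_subtype_eq (LinearMap.range g) (LinearMap.ker (f.domRestrict (LinearMap.range g)))]
    refine Submodule.finrank_mono ?_
    rintro _ ⟨x, hx, rfl⟩
    rw [SetLike.mem_coe, LinearMap.mem_ker, LinearMap.domRestrict_apply] at hx
    exact hx
  omega

/-- **SYLVESTER FOR A SANDWICH OF MATRICES**: if `Aᵀ : K^D → K^a` has rank `a` (`A` injective), `M : K^D → K^D` is injective and `B : K^b → K^D` is injective, then
`a + b ≤ D + rank (Aᵀ M B)`. -/
theorem rank_sandwich_ge {ι : Type*} [Fintype ι] [DecidableEq ι] {a b : ℕ} (A : Matrix ι (Fin a) K) (M : Matrix ι ι K) (B : Matrix ι (Fin b) K)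
    (hA : Function.Injective A.mulVecLin) (hM : Function.Injective M.mulVecLin) (hB : Function.Injective B.mulVecLin) :
    a + b ≤ Fintype.card ι + (Aᵀ * M * B).rank := by
  -- rank B = b, rank (Aᵀ M) = a with kernel of dimension D − a
  have hBr : finrank K (LinearMap.range B.mulVecLin) = b := by
    rw [LinearMap.finrank_range_of_inj hB, finrank_fintype_fun_eq_card, Fintype.card_fin]
  have hAM : Function.Surjective (Aᵀ * M).mulVecLin := by
    rw [← LinearMap.range_eq_top, Matrix.mulVecLin_mul, LinearMap.range_comp_of_range_eq_top]
    · apply Submodule.eq_top_of_finrank_eq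
      rw [← Matrix.rank, Matrix.rank_transpose, Matrix.rank, LinearMap.finrank_range_of_inj hA]
    · rw [LinearMap.range_eq_top]
      exact (LinearMap.injective_iff_surjective_of_finrank_eq_finrank rfl).mp hM
  have hker := LinearMap.finrank_range_add_finrank_ker (Aᵀ * M).mulVecLin
  rw [LinearMap.range_eq_top.mpr hAM, finrank_top, finrank_fintype_fun_eq_card, Fintype.card_fin, finrank_fintype_fun_eq_card] at hker
  have hs := finrank_range_le_finrank_range_comp_add K (Aᵀ * M).mulVecLin B.mulVecLin
  rw [hBr, ← Matrix.mulVecLin_mul, ← Matrix.rank] at hs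
  omega

/-! ## §127. The fourth regime: the Sylvester window -/

/-- the size bounds: `rank H_k ≤ k + 1` and `rank H_k ≤ n + 1 − k` (rows and columns of the catalecticant). -/
theorem rank_hankel1_le_min (n k : ℕ) (q : ℕ → K) : (hankel1 K n k q).rank ≤ min (k + 1) (n + 1 - k) := by
  refine le_min ?_ ?_
  · have h := Matrix.rank_le_card_height (hankel1 K n k q); rwa [Fintype.card_fin] at h
  · have h := Matrix.rank_le_card_width (hankel1 K n k q); rwa [Fintype.card_fin] at h

/-- **THE FOURTH REGIME, LOWER BOUND: `n + 2 ≤ D + rank H_k(Σ_i expMul λ_i q_i)`** for distinct nodes `λ_i`, exact orders `P_i` (`q_i` supported on `[0, P_i]`, `q_i(P_i) ≠ 0`),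
`k ≤ n` and `k + 1 ≤ D`, `n + 1 − k ≤ D` — both confluent node matrices have full rank (F2c), the Hankel-of-coefficients matrix is invertible (F2a), Sylvester. -/
theorem rank_hankel1_expMul_sum_ge {n k r : ℕ} (hk : k ≤ n) {lam : Fin r → K} (hlam : Function.Injective lam) {P : Fin r → ℕ} {q : Fin r → ℕ → K}
    (hq : ∀ i j, P i < j → q i j = 0) (hqP : ∀ i, q i (P i) ≠ 0) (hDk : k + 1 ≤ ∑ i, (P i + 1)) (hDn : n + 1 - k ≤ ∑ i, (P i + 1)) :
    n + 2 ≤ ∑ i, (P i + 1) + (hankel1 K n k (fun j => ∑ i, expMul K (lam i) (q i) j)).rank := by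
  have h := rank_sandwich_ge K (cvMat K lam P (k + 1)) (hkMat K P q) (cvMat K lam P (n + 1 - k)) (cvMat_mulVecLin_injective K hlam P hDk)
    (hkMat_mulVecLin_injective K P hq hqP) (cvMat_mulVecLin_injective K hlam P hDn)
  rw [← hankel1_expMul_sum K n k lam hq, card_DIdx] at h
  omega

/-- **THE SYLVESTER WINDOW OF THE FOURTH REGIME**: under the same hypotheses `n + 2 − D ≤ rank H_k ≤ min(k+1, n+1−k)` (truncated subtraction; the upper bound holds for every
class, and `rank H_k ≤ D` as well by F2a `rank_hankel1_expMul_sum_le`). -/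
theorem rank_hankel1_expMul_sum_window {n k r : ℕ} (hk : k ≤ n) {lam : Fin r → K} (hlam : Function.Injective lam) {P : Fin r → ℕ} {q : Fin r → ℕ → K}
    (hq : ∀ i j, P i < j → q i j = 0) (hqP : ∀ i, q i (P i) ≠ 0) (hDk : k + 1 ≤ ∑ i, (P i + 1)) (hDn : n + 1 - k ≤ ∑ i, (P i + 1)) :
    n + 2 - ∑ i, (P i + 1) ≤ (hankel1 K n k (fun j => ∑ i, expMul K (lam i) (q i) j)).rank ∧
      (hankel1 K n k (fun j => ∑ i, expMul K (lam i) (q i) j)).rank ≤ min (k + 1) (n + 1 - k) := by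
  refine ⟨?_, rank_hankel1_le_min K n k _⟩
  have h := rank_hankel1_expMul_sum_ge K hk hlam hq hqP hDk hDn
  omega

/-- the kernel side (THEOREM H): in the fourth regime `dim Kr(univ, class, k) ≤ C(2n,k) − (n + 2 − D)·C(n,k)`, i.e. **`dim Kr + (n + 2 − D)·C(n,k) ≤ C(2n,k)`**. -/
theorem finrank_Kr_w_expMul_sum_le_of_ge {n k r : ℕ} (hk : k ≤ n) {lam : Fin r → K} (hlam : Function.Injective lam) {P : Fin r → ℕ} {q : Fin r → ℕ → K}
    (hq : ∀ i j, P i < j → q i j = 0) (hqP : ∀ i, q i (P i) ≠ 0) (hDk : k + 1 ≤ ∑ i, (P i + 1)) (hDn : n + 1 - k ≤ ∑ i, (P i + 1)) :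
    finrank K (KunnethKernel.Kr K Finset.univ (w K n n (fun j => ∑ i, expMul K (lam i) (q i) j)) k) + (n + 2 - ∑ i, (P i + 1)) * n.choose k ≤ (n + n).choose k := by
  have h1 := HankelSiegelIdeal.finrank_Kr_w_add_rank K (n := n) k (fun j => ∑ i, expMul K (lam i) (q i) j)
  have h2 := (rank_hankel1_expMul_sum_window K hk hlam hq hqP hDk hDn).1
  have h3 : (n + 2 - ∑ i, (P i + 1)) * n.choose k ≤ n.choose k * (hankel1 K n k (fun j => ∑ i, expMul K (lam i) (q i) j)).rank := by
    rw [Nat.mul_comm]; exact Nat.mul_le_mul_left _ h2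
  omega

/-! ## §128. The boundary of the fourth regime -/

/-- **AT THE BOUNDARY THE WINDOW COLLAPSES**: for `D = max(k+1, n+1−k)` the lower bound `n + 2 − D` equals `min(k+1, n+1−k)`, so `rank H_k = min(k+1, n+1−k)` — G9's three-regime
value, recovered from Sylvester alone (the fourth regime proper starts at `D = max + 1`, where the window has at least two values). -/
theorem rank_hankel1_expMul_sum_boundary {n k r : ℕ} (hk : k ≤ n) {lam : Fin r → K} (hlam : Function.Injective lam) {P : Fin r → ℕ} {q : Fin r → ℕ → K}
    (hq : ∀ i j, P i < j → q i j = 0) (hqP : ∀ i, q i (P i) ≠ 0) (hD : ∑ i, (P i + 1) = max (k + 1) (n + 1 - k)) :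
    (hankel1 K n k (fun j => ∑ i, expMul K (lam i) (q i) j)).rank = min (k + 1) (n + 1 - k) := by
  have hDk : k + 1 ≤ ∑ i, (P i + 1) := hD ▸ le_max_left _ _
  have hDn : n + 1 - k ≤ ∑ i, (P i + 1) := hD ▸ le_max_right _ _
  have h := rank_hankel1_expMul_sum_window K hk hlam hq hqP hDk hDn
  rcases le_total (k + 1) (n + 1 - k) with h' | h'
  · rw [max_eq_right h'] at hD; rw [min_eq_left h'] at h ⊢; omega
  · rw [max_eq_left h'] at hD; rw [min_eq_right h'] at h ⊢; omega

/-- the window's WIDTH in the fourth regime proper: for `max(k+1, n+1−k) < D` there are `D − max(k+1, n+1−k) + 1 ≥ 2` integers between the bounds — the arithmetic behind «no law»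
(`n + 2 − D < min(k+1, n+1−k)` there; stated as an inequality of naturals). -/
theorem fourth_regime_window_width {n k D : ℕ} (hk : k ≤ n) (hD : max (k + 1) (n + 1 - k) < D) : n + 2 - D < min (k + 1) (n + 1 - k) := by
  rcases le_total (k + 1) (n + 1 - k) with h' | h'
  · rw [max_eq_right h'] at hD; rw [min_eq_left h']; omega
  · rw [max_eq_left h'] at hD; rw [min_eq_right h']; omega

end Summit.Ventures.HSemireg.Wedge.HankelFrameChange
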